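import Mathlib
import Summits.MatrixMultiplication.Statement
import Summits.MatrixMultiplication.MatrixMultiplication.Theorems.GraphEquationsNullExp
import Summits.MatrixMultiplication.MatrixMultiplication.Theorems.GraphEquationsDeepDeflation

/-!
# Graph equations — THE MEMBERSHIP-EXPONENT LADDER AND ITS BRIDGE (M19e)

The finite range of `MultiplicityReduction` indexed by the MEMBERSHIP EXPONENT `e` instead of the
isolation order `K`.  Rung `e` (spelled out below, no new definition) says:

  NEP_e :  for `β ≥ 2`, a cost-`n^β` family of CORRECT systems with `f_q^e ∈ J_E` for all `q`
           forces `EqAdmissibleRed β'` for every `β' > β`.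

* `nullExpPurification_of_multiplicityReduction` — every rung is NECESSARY for the crux
  (`MultiplicityReduction ⇒ NEP_e` for all `e`, trivially: such a family is admissible).
* `nullExpPurification_of_boundedOrderPurification` — rung `e` of this ladder is WEAKER than rung
  `K = e` of BOP′ (`EqAdmissibleIdealIso β e ⇒ pure`), by `eqAdmissibleIdealIso_of_generator_pow_mem`
  (M19b: `f_q^e ∈ J_E ⇒` ideal isolation of order `e` at every base).
* `nullExpPurification_one`, `nullExpPurification_two` — rungs `e ≤ 2` are THEOREMS
  (`omega_le_of_generator_sq_mem`).
* `multiplicityReduction_of_nullExpReduction_of_nullExpPurification` — **THE BRIDGE**: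
  NER (uniform membership exponent along cheaper families; NECESSARY, `nullExpReduction_of_
  matrixMultiplication`) `∧ (∀ e ≥ 1, NEP_e) ⇒ MultiplicityReduction`, kernel-checked.

WHY THIS INDEXING (lens 5, NODE-g32 rev 3).  The distinguished members `f_q^e` have DIAGONAL
lowest forms `F_q^e`; a deflation step along a direction field `ξ` with `ξ(y) = γ` maps them to
`e·ξ_q·f_q^{e-1}`, lowest forms `e γ_q F_q^{e-1}` — diagonal again.  The generic-polar input that
the `K`-indexed rungs `K ≥ 3` require for ARBITRARY top forms (`GenericPolarStep`) is therefore
vacuous on this ladder: a generic `γ` in the kernel `L = ker J_C(y)` has `γ_q ≠ 0` at every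
position `q` not already covered by a linear member form, and since direction fields live in
`ℂ[A,B]` (`derivC`), `e-1` steps turn the member `f_q^e` into the member `e!·(∏_j ξ^{(j)}_q)·f_q`
EXACTLY, with a multiplier that is a unit at `y`.  In the deep regime the step is even a
correct-system-to-correct-system map (`GraphEquationsDeepDeflation`, all rungs proved on tight
families); in the shallow regime it is the program-level jet engine of rung `2` iterated (kernel
sections with parameters, iterated Taylor garbage) — BLUEPRINT (NODE-g32 rev 3): a typing task of
the rung-`2` kind with no classical input beyond the tree.
-/

set_option linter.dupNamespace false

noncomputable section

open scoped BigOperators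

namespace Summit.MatrixMultiplication.MatrixMultiplication.Theorems.GraphEquations

open MvPolynomial
open Literature.Computability.AlgebraicComplexity

/-- **Every rung is necessary**: `MultiplicityReduction ⇒ NEP_e` for every `e` — a family with
`f_q^e ∈ J_E` at cost `n^β` is in particular admissible at `β`. -/
theorem nullExpPurification_of_multiplicityReduction (hMR : MultiplicityReduction) (e : ℕ) :
    ∀ β : ℝ, 2 ≤ β →
      (∃ c : ℝ, ∀ n : ℕ, 1 ≤ n → ∃ E : EqSystem n, E.Correct ∧
        (∀ q : Fin n × Fin n, generator n q ^ e ∈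
          Ideal.span (Set.range fun o : Fin E.tests.length => E.testPoly (E.tests.get o))) ∧
        (E.cost : ℝ) ≤ c * (n : ℝ) ^ β) →
      ∀ β' : ℝ, β < β' → EqAdmissibleRed β' := by
  intro β hβ h β' hβ'
  obtain ⟨c, hc⟩ := h
  exact hMR β hβ ⟨c, fun n hn => by obtain ⟨E, hE, -, hcost⟩ := hc n hn; exact ⟨E, hE, hcost⟩⟩ β' hβ'

/-- **Rung `e` of the membership ladder is weaker than rung `K = e` of BOP′** (`1 ≤ e`):
uniform membership exponent `e` gives uniform ideal isolation of order `e` (M19b), and purity at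
the midpoint exponent gives reducedness above it. -/
theorem nullExpPurification_of_boundedOrderPurification {e : ℕ} (he : 1 ≤ e)
    (hBOP : ∀ β : ℝ, 2 ≤ β → EqAdmissibleIdealIso β e → ∀ β' : ℝ, β < β' → EqAdmissiblePure β') :
    ∀ β : ℝ, 2 ≤ β →
      (∃ c : ℝ, ∀ n : ℕ, 1 ≤ n → ∃ E : EqSystem n, E.Correct ∧
        (∀ q : Fin n × Fin n, generator n q ^ e ∈
          Ideal.span (Set.range fun o : Fin E.tests.length => E.testPoly (E.tests.get o))) ∧
        (E.cost : ℝ) ≤ c * (n : ℝ) ^ β) →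
      ∀ β' : ℝ, β < β' → EqAdmissibleRed β' := by
  intro β hβ h β' hβ'
  have hiso : EqAdmissibleIdealIso β e := eqAdmissibleIdealIso_of_generator_pow_mem he h
  have hpure : EqAdmissiblePure ((β + β') / 2) := hBOP β hβ hiso _ (by linarith)
  exact eqAdmissibleRed_of_omega_lt (hpure.omega_le.trans_lt (by linarith))

/-- **Rung `e = 2` is a theorem** (the square-membership criterion `omega_le_of_generator_sq_mem`). -/
theorem nullExpPurification_two :
    ∀ β : ℝ, 2 ≤ β →
      (∃ c : ℝ, ∀ n : ℕ, 1 ≤ n → ∃ E : EqSystem n, E.Correct ∧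
        (∀ q : Fin n × Fin n, generator n q ^ 2 ∈
          Ideal.span (Set.range fun o : Fin E.tests.length => E.testPoly (E.tests.get o))) ∧
        (E.cost : ℝ) ≤ c * (n : ℝ) ^ β) →
      ∀ β' : ℝ, β < β' → EqAdmissibleRed β' := fun _ hβ h _ hβ' =>
  eqAdmissibleRed_of_omega_lt ((omega_le_of_generator_sq_mem hβ h).trans_lt hβ')

/-- **Rung `e = 1` is a theorem** (`f_q ∈ J_E ⇒ f_q² ∈ J_E`). -/
theorem nullExpPurification_one :
    ∀ β : ℝ, 2 ≤ β →
      (∃ c : ℝ, ∀ n : ℕ, 1 ≤ n → ∃ E : EqSystem n, E.Correct ∧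
        (∀ q : Fin n × Fin n, generator n q ^ 1 ∈
          Ideal.span (Set.range fun o : Fin E.tests.length => E.testPoly (E.tests.get o))) ∧
        (E.cost : ℝ) ≤ c * (n : ℝ) ^ β) →
      ∀ β' : ℝ, β < β' → EqAdmissibleRed β' := by
  intro β hβ h β' hβ'
  obtain ⟨c, hc⟩ := h
  refine nullExpPurification_two β hβ ⟨c, fun n hn => ?_⟩ β' hβ'
  obtain ⟨E, hE, hmem, hcost⟩ := hc n hn
  refine ⟨E, hE, fun q => ?_, hcost⟩
  rw [pow_succ]
  exact Ideal.mul_mem_left _ _ (by simpa only [pow_one] using hmem q)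

/-- **Rungs of every height on TIGHT families are theorems** (`GraphEquationsDeepDeflation`):
the membership ladder restricted to families whose tests lie in `I^{e-1}`. -/
theorem nullExpPurification_of_tight (k : ℕ) :
    ∀ β : ℝ, 2 ≤ β →
      (∃ c : ℝ, ∀ n : ℕ, 1 ≤ n → ∃ E : EqSystem n, E.Correct ∧
        (∀ j ∈ E.tests, E.testPoly j ∈ graphIdeal n ^ (k + 1)) ∧
        (∀ q : Fin n × Fin n, generator n q ^ (k + 2) ∈
          Ideal.span (Set.range fun o : Fin E.tests.length => E.testPoly (E.tests.get o))) ∧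
        (E.cost : ℝ) ≤ c * (n : ℝ) ^ β) →
      ∀ β' : ℝ, β < β' → EqAdmissibleRed β' := fun _ hβ h =>
  eqAdmissibleRed_of_generator_pow_mem_of_deep hβ k h

/-- **THE BRIDGE OF THE MEMBERSHIP LADDER.**  NER (for every admissible `β` and every `β' > β`,
SOME exponent `e ≥ 1` and a cost-`n^{β'}` family of correct systems with `f_q^e ∈ J_E`) together
with every rung NEP_e (`e ≥ 1`) gives `MultiplicityReduction`: apply NER at the midpoint exponent,
then the rung it names.  NER is necessary (`nullExpReduction_of_matrixMultiplication`); every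
rung is necessary (`nullExpPurification_of_multiplicityReduction`); rungs `e ≤ 2` and all tight
rungs are proved. -/
theorem multiplicityReduction_of_nullExpReduction_of_nullExpPurification
    (hNER : ∀ β : ℝ, 2 ≤ β → EqAdmissible β → ∀ β' : ℝ, β < β' →
      ∃ e : ℕ, 1 ≤ e ∧ ∃ c : ℝ, ∀ n : ℕ, 1 ≤ n → ∃ E : EqSystem n, E.Correct ∧
        (∀ q : Fin n × Fin n, generator n q ^ e ∈
          Ideal.span (Set.range fun o : Fin E.tests.length => E.testPoly (E.tests.get o))) ∧
        (E.cost : ℝ) ≤ c * (n : ℝ) ^ β')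
    (hNEP : ∀ e : ℕ, 1 ≤ e → ∀ β : ℝ, 2 ≤ β →
      (∃ c : ℝ, ∀ n : ℕ, 1 ≤ n → ∃ E : EqSystem n, E.Correct ∧
        (∀ q : Fin n × Fin n, generator n q ^ e ∈
          Ideal.span (Set.range fun o : Fin E.tests.length => E.testPoly (E.tests.get o))) ∧
        (E.cost : ℝ) ≤ c * (n : ℝ) ^ β) →
      ∀ β' : ℝ, β < β' → EqAdmissibleRed β') :
    MultiplicityReduction := by
  intro β hβ hA β' hβ'
  obtain ⟨e, he, c, hc⟩ := hNER β hβ hA ((β + β') / 2) (by linarith)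
  exact hNEP e he ((β + β') / 2) (by linarith) ⟨c, hc⟩ β' (by linarith)

/-- **Where the crux now stands on this ladder**: given NER, `MultiplicityReduction` follows from
the rungs `e ≥ 3` ALONE (rungs `1, 2` being theorems). -/
theorem multiplicityReduction_of_nullExpReduction_of_rungs_ge_three
    (hNER : ∀ β : ℝ, 2 ≤ β → EqAdmissible β → ∀ β' : ℝ, β < β' →
      ∃ e : ℕ, 1 ≤ e ∧ ∃ c : ℝ, ∀ n : ℕ, 1 ≤ n → ∃ E : EqSystem n, E.Correct ∧
        (∀ q : Fin n × Fin n, generator n q ^ e ∈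
          Ideal.span (Set.range fun o : Fin E.tests.length => E.testPoly (E.tests.get o))) ∧
        (E.cost : ℝ) ≤ c * (n : ℝ) ^ β')
    (hNEP : ∀ e : ℕ, 3 ≤ e → ∀ β : ℝ, 2 ≤ β →
      (∃ c : ℝ, ∀ n : ℕ, 1 ≤ n → ∃ E : EqSystem n, E.Correct ∧
        (∀ q : Fin n × Fin n, generator n q ^ e ∈
          Ideal.span (Set.range fun o : Fin E.tests.length => E.testPoly (E.tests.get o))) ∧
        (E.cost : ℝ) ≤ c * (n : ℝ) ^ β) →
      ∀ β' : ℝ, β < β' → EqAdmissibleRed β') :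
    MultiplicityReduction := by
  refine multiplicityReduction_of_nullExpReduction_of_nullExpPurification hNER fun e he => ?_
  rcases Nat.lt_or_ge e 3 with h3 | h3
  · interval_cases e
    · exact nullExpPurification_one
    · exact nullExpPurification_two
  · exact hNEP e h3

end Summit.MatrixMultiplication.MatrixMultiplication.Theorems.GraphEquations

end
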